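import Summits.Ventures.CertifiedArithmetic.LowPrec.SRCountingChain
import HarnessLib

/-!
# Stochastic rounding into a finite format, XXVI: the Wald identity of saturating SR accumulation

HONEST FRAMING: certified error envelopes and provably optimal rounding/accumulation schemes for
low-precision formats under stated cost models; every table by two implementations; no hardware or
vendor claims.

Venture CertifiedArithmetic / lowprec, SR slice (gen6).  File XXIV made the recursive SR summation
of a constant increment `c > 0` a Markov chain on the format `F` (greatest value `hi`) and computed
its saturation law format by format.  This file proves the FORMAT-FREE identities behind those laws
(arbitrary finite `F ⊆ K`, any linear ordered field):
* `treeMean_comb_eq_sub_sum` (no hypothesis): `E ŝₙ = s + n·c − ∑_{k<n} E[excess(ŝ_k)]`,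
  `excess(a) = a + c − clamp(a + c)` = the part of an increment lost to saturation;
* `treeExp_exitNow_eq_hitProb`: saturation is ABSORBING for the constant chain —
  `P(step k+1 saturates) = P(some step ≤ k+1 saturates) = h_{k+1}(s)` (file XXIV's recursion);
* **Wald identity** (`wald_mean`, `wald_bias`, `wald_mean_eq_meanSteps`): if no format value lies
  in the open top gap `(hi − c, hi)` (every increment below the top is absorbed in full), then
  `E ŝₙ = s + n·c − c·∑_{j=1}^{n} h_j(s) = s + c·E[min(τ, n)]` EXACTLY (`τ` = number of absorbed
  increments): the bias is `−c·E[number of saturating steps among the first n]`; without the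
  top-gap hypothesis the identity survives as `≥` (`wald_mean_ge`);
* **expected time to saturation** (`meanSteps_two_sided`): for every `n`,
  `(hi − s)(1 − (hi − lo)/(c(n+1))) ≤ c·E[min(τ, n)] ≤ hi − s`, so `E[τ] = (hi − s)/c`
  (E2M1 counting by ones from `0`: six increments absorbed on average, E3M2: 28);
* **survival bound, every format, no enumeration** (`survival_le`, `format_survival_le`):
  `P(not saturated after n increments of c from s) ≤ (maxRat − s)/(c·n)`;
* E2M1 closed form for every `n` (`Count.e2m1_mean_ones`): from `1`, `E ŝ_{m+4} = 6 − 2^{−m}`.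

Dictionary to the counter literature (Morris 1978; Flajolet 1985; Csűrös 2010, arXiv:0904.3062): the
identity is optional stopping for the martingale `ŝ_{k∧τ} − c·(k∧τ)`; specific here are the
absorbing top value of a FINITE format (the counter papers let the register grow) and the exact,
hypothesis-explicit bias.  No claim about any implementation.
-/

namespace Summit.Ventures.CertifiedArithmetic.LowPrec.SR

open Literature.ComputerArithmetic.ConnollyHighamMary2021
open Literature.ComputerArithmetic.FloatingPoint Finset STree

variable {K : Type*} [Field K] [LinearOrder K] [IsStrictOrderedRing K]

/-! ### The upper-exit predicate, the Markov property, steps above the top -/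

/-- Upper exit predicate of a format with greatest value `hi`: `e(x) = [hi < x]`. -/
def upX (hi : K) : K → Bool := fun x => decide (hi < x)

omit [Field K] [IsStrictOrderedRing K] in
/-- The upper exit predicate fires only above `hi`. -/
theorem upX_imp (hi : K) : ∀ x, upX hi x = true → hi ≤ x :=
  fun x hx => le_of_lt (by simpa [upX] using hx)

omit [IsStrictOrderedRing K] in
/-- The `k`-fold Markov operator is file II's backward recursion for the constant sequence. -/
theorem iterOp_eq_accExp (F : Finset K) (c : K) (k : ℕ) (f : K → K) (a : K) :
    iterOp F c k f a = accExp F (fun _ => c) k f a := by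
  rw [← treeExp_comb_const, treeExp_comb]

omit [IsStrictOrderedRing K] in
/-- **Markov property, first-step form**: `E_a f(ŝ_{k+1}) = E[(E_· f(ŝ_k))(SR(a + c))]`. -/
theorem iterOp_succ_left (F : Finset K) (c : K) (k : ℕ) (f : K → K) (a : K) :
    iterOp F c (k + 1) f a = step F (a + c) (iterOp F c k f) := by
  rw [iterOp_eq_accExp]
  simp only [accExp]
  congr 1
  funext b
  rw [iterOp_eq_accExp]

omit [Field K] [IsStrictOrderedRing K] in
/-- At or above the greatest value, clamping returns the greatest value. -/
theorem clamp_of_top_le {F : Finset K} {hi x : K} (hhi : hi ∈ F) (hb : ∀ y ∈ F, y ≤ hi)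
    (hx : hi ≤ x) : clamp F x = hi := by
  have hF : F.Nonempty := ⟨hi, hhi⟩
  refine le_antisymm ?_ ?_
  · obtain ⟨z, hz, hcz⟩ := (clamp_inHull hF x).2
    exact hcz.trans (hb z hz)
  · have h1 : clamp F hi = hi := clamp_eq_self ⟨⟨hi, hhi, le_rfl⟩, ⟨hi, hhi, le_rfl⟩⟩
    calc hi = clamp F hi := h1.symm
      _ ≤ clamp F x := clamp_mono hF hx

omit [IsStrictOrderedRing K] in
/-- At or above the greatest value an SR step returns `hi` surely: `E g(SR x) = g hi`. -/
theorem step_of_top_le {F : Finset K} {hi x : K} (hhi : hi ∈ F) (hb : ∀ y ∈ F, y ≤ hi)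
    (hx : hi ≤ x) (g : K → K) : step F x g = g hi := by
  unfold step pUp up dn
  rw [clamp_of_top_le hhi hb hx, roundUp_eq_self_of_mem hhi, roundDown_eq_self_of_mem hhi]; ring

omit [IsStrictOrderedRing K] in
/-- Started at a format value, every partial sum of a left comb is a format value. -/
theorem allOut_mem_comb {F : Finset K} {s : K} (hs : s ∈ F) (x : ℕ → K) :
    ∀ k : ℕ, AllOut F (comb x s k) (fun v => v ∈ F)
  | 0 => hs
  | _ + 1 => allOut_mem_node F ⟨s, hs⟩ _ _

omit [IsStrictOrderedRing K] in
/-- Subtraction under the expectation. -/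
theorem treeExp_sub (F : Finset K) (t : STree K) (f g : K → K) :
    treeExp F t (fun v => f v - g v) = treeExp F t f - treeExp F t g := by
  rw [sub_eq_add_neg, ← neg_one_mul, ← treeExp_mul_left, ← treeExp_add]
  exact treeExp_congr F t (fun v => by ring)

/-! ### Saturation is absorbing: exit now = exited by now -/

omit [IsStrictOrderedRing K] in
/-- **`P(step k+1 exits) = h_{k+1}(s)`** for the constant-increment chain: once a step exits (the
value is then `hi`), every later step exits too, so "step `k+1` exits" and "some step `≤ k+1`
exits" have the same probability.  Hypotheses: the exit predicate fires only above `hi` and does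
fire at `hi + c`. -/
theorem treeExp_exitNow_eq_hitProb {F : Finset K} {hi : K} (hhi : hi ∈ F) (hb : ∀ y ∈ F, y ≤ hi)
    {e : K → Bool} (he : ∀ x, e x = true → hi ≤ x) {c : K} (hec : e (hi + c) = true) (s : K)
    (k : ℕ) : treeExp F (comb (fun _ => c) s k) (fun a => if e (a + c) then 1 else 0)
      = hitProb F e c (k + 1) s := by
  induction k generalizing s with
  | zero =>
      simp only [comb, treeExp, hitProb, step_const]
  | succ k ih =>
      rw [treeExp_comb_const, iterOp_succ_left]
      have hfun : iterOp F c k (fun a => if e (a + c) then (1 : K) else 0)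
          = hitProb F e c (k + 1) := by
        funext a; rw [← treeExp_comb_const]; exact ih a
      rw [hfun]
      conv_rhs => rw [hitProb]
      cases hsc : e (s + c)
      · simp
      · rw [if_pos rfl, step_of_top_le hhi hb (he _ hsc)]
        simp [hitProb, hec]

/-- The hitting probability is nondecreasing in the number of steps. -/
theorem hitProb_mono_steps (F : Finset K) (e : K → Bool) (c s : K) {k k' : ℕ} (h : k ≤ k') :
    hitProb F e c k s ≤ hitProb F e c k' s := by
  rw [← exitE_comb_const_eq_hitProb, ← exitE_comb_const_eq_hitProb]
  exact exitE_comb_mono F e _ s h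

/-! ### The mean of the constant chain: lost increments -/

omit [IsStrictOrderedRing K] in
/-- One step of the mean: `E ŝ_{k+1} = E ŝ_k + c − E[excess(ŝ_k)]`,
`excess(a) = a + c − clamp(a + c)`. -/
theorem treeMean_comb_succ (F : Finset K) (c s : K) (k : ℕ) :
    treeExp F (comb (fun _ => c) s (k + 1)) (fun v => v)
      = treeExp F (comb (fun _ => c) s k) (fun v => v) + c
        - treeExp F (comb (fun _ => c) s k) (fun a => a + c - clamp F (a + c)) := by
  simp only [comb, treeExp]
  have h : ∀ a, step F (a + c) (fun v => v) = (a + c) - (a + c - clamp F (a + c)) := fun a => by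
    rw [step_id]; ring
  rw [treeExp_congr F _ h, treeExp_sub F _ (fun a => a + c) (fun a => a + c - clamp F (a + c)),
    treeExp_add_const F _ (fun v => v) c]

omit [IsStrictOrderedRing K] in
/-- **Mean of saturating SR accumulation of a constant (no hypothesis):**
`E ŝₙ = s + n·c − ∑_{k<n} E[excess(ŝ_k)]`. -/
theorem treeMean_comb_eq_sub_sum (F : Finset K) (c s : K) (n : ℕ) :
    treeExp F (comb (fun _ => c) s n) (fun v => v)
      = s + n * c - ∑ k ∈ range n, treeExp F (comb (fun _ => c) s k)
          (fun a => a + c - clamp F (a + c)) := by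
  induction n with
  | zero => simp [comb, treeExp]
  | succ n ih => rw [treeMean_comb_succ, ih, sum_range_succ]; push_cast; ring

/-- The lost increment at a format value is nonnegative and at most `c·[hi < a + c]`. -/
theorem excess_bounds {F : Finset K} {hi : K} (hhi : hi ∈ F) (hb : ∀ y ∈ F, y ≤ hi) {c : K}
    (hc : 0 ≤ c) {a : K} (ha : a ∈ F) :
    0 ≤ a + c - clamp F (a + c) ∧ a + c - clamp F (a + c) ≤ c * (if hi < a + c then 1 else 0) := by
  by_cases h : hi < a + c
  · rw [if_pos h, clamp_of_top_le hhi hb h.le]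
    have := hb a ha
    constructor <;> linarith
  · rw [if_neg h]
    have hin : InHull F (a + c) := ⟨⟨a, ha, by linarith⟩, ⟨hi, hhi, not_lt.mp h⟩⟩
    rw [clamp_eq_self hin]; simp

/-- Under the TOP-GAP hypothesis (no format value in `(hi − c, hi)`), the lost increment at a format
value `a` is exactly `c·[hi < a + c]` (`= c·[a = hi]`). -/
theorem excess_eq {F : Finset K} {hi : K} (hhi : hi ∈ F) (hb : ∀ y ∈ F, y ≤ hi) {c : K}
    (hc : 0 ≤ c) (hgap : ∀ y ∈ F, y < hi → y + c ≤ hi) {a : K} (ha : a ∈ F) :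
    a + c - clamp F (a + c) = c * (if hi < a + c then 1 else 0) := by
  by_cases h : hi < a + c
  · rw [if_pos h, clamp_of_top_le hhi hb h.le]
    have h1 : a = hi := by
      rcases (hb a ha).lt_or_eq with hlt | heq
      · exact absurd (hgap a ha hlt) (not_le.mpr h)
      · exact heq
    rw [h1]; ring
  · rw [if_neg h]
    have hin : InHull F (a + c) := ⟨⟨a, ha, by linarith⟩, ⟨hi, hhi, not_lt.mp h⟩⟩
    rw [clamp_eq_self hin]; ring

/-- Under the top-gap hypothesis the upper exit `[hi < a + c]` at a format value `a` is the event
`a = hi` (for `c > 0`). -/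
theorem upX_add_iff_eq {F : Finset K} {hi : K} (hb : ∀ y ∈ F, y ≤ hi) {c : K} (hc : 0 < c)
    (hgap : ∀ y ∈ F, y < hi → y + c ≤ hi) {a : K} (ha : a ∈ F) : hi < a + c ↔ a = hi := by
  constructor
  · intro h
    rcases (hb a ha).lt_or_eq with hlt | heq
    · exact absurd (hgap a ha hlt) (not_le.mpr h)
    · exact heq
  · rintro rfl; linarith

/-! ### The Wald identity -/

/-- **Lost increments = saturating steps**: under the top-gap hypothesis,
`E[excess(ŝ_k)] = c·h_{k+1}(s)`. -/
theorem treeExp_excess_eq {F : Finset K} {hi : K} (hhi : hi ∈ F) (hb : ∀ y ∈ F, y ≤ hi) {c : K}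
    (hc : 0 < c) (hgap : ∀ y ∈ F, y < hi → y + c ≤ hi) {s : K} (hs : s ∈ F) (k : ℕ) :
    treeExp F (comb (fun _ => c) s k) (fun a => a + c - clamp F (a + c))
      = c * hitProb F (upX hi) c (k + 1) s := by
  have hec : upX hi (hi + c) = true := by simpa [upX] using hc
  rw [← treeExp_exitNow_eq_hitProb hhi hb (upX_imp hi) hec s k, ← treeExp_mul_left]
  refine treeExp_congr_of_allOut F _ (allOut_mono F _ (fun a ha => ?_) (allOut_mem_comb hs _ k))
  rw [excess_eq hhi hb hc.le hgap ha]
  simp [upX]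

/-- **Wald identity for saturating SR accumulation of a constant.**  Under the top-gap hypothesis,
`E ŝₙ = s + n·c − c·∑_{j=1}^{n} h_j(s)`: the bias is `−c` times the expected number of saturating
steps among the first `n`. -/
theorem wald_mean {F : Finset K} {hi : K} (hhi : hi ∈ F) (hb : ∀ y ∈ F, y ≤ hi) {c : K}
    (hc : 0 < c) (hgap : ∀ y ∈ F, y < hi → y + c ≤ hi) {s : K} (hs : s ∈ F) (n : ℕ) :
    treeExp F (comb (fun _ => c) s n) (fun v => v)
      = s + n * c - c * ∑ k ∈ range n, hitProb F (upX hi) c (k + 1) s := by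
  rw [treeMean_comb_eq_sub_sum, mul_sum]
  congr 1
  exact sum_congr rfl (fun k _ => treeExp_excess_eq hhi hb hc hgap hs k)

/-- **The bias, exactly**: `treeBias = −c·∑_{j=1}^{n} h_j(s)` under the top-gap hypothesis. -/
theorem wald_bias {F : Finset K} {hi : K} (hhi : hi ∈ F) (hb : ∀ y ∈ F, y ≤ hi) {c : K}
    (hc : 0 < c) (hgap : ∀ y ∈ F, y < hi → y + c ≤ hi) {s : K} (hs : s ∈ F) (n : ℕ) :
    treeBias F (comb (fun _ => c) s n) = -(c * ∑ k ∈ range n, hitProb F (upX hi) c (k + 1) s) := by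
  have h := wald_mean hhi hb hc hgap hs n
  rw [treeExp_id, exact_comb, sum_const, card_range, nsmul_eq_mul] at h
  linarith

/-- **Without the top-gap hypothesis** the Wald identity survives as a lower bound on the mean
(an increment may be lost only partially): `s + n·c − c·∑_{j≤n} h_j(s) ≤ E ŝₙ`. -/
theorem wald_mean_ge {F : Finset K} {hi : K} (hhi : hi ∈ F) (hb : ∀ y ∈ F, y ≤ hi) {c : K}
    (hc : 0 < c) {s : K} (hs : s ∈ F) (n : ℕ) :
    s + n * c - c * ∑ k ∈ range n, hitProb F (upX hi) c (k + 1) s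
      ≤ treeExp F (comb (fun _ => c) s n) (fun v => v) := by
  have hec : upX hi (hi + c) = true := by simpa [upX] using hc
  rw [treeMean_comb_eq_sub_sum, mul_sum]
  refine sub_le_sub_left (sum_le_sum fun k _ => ?_) _
  rw [← treeExp_exitNow_eq_hitProb hhi hb (upX_imp hi) hec s k, ← treeExp_mul_left]
  refine treeExp_mono_of_allOut F _ (allOut_mono F _ (fun a ha => ?_) (allOut_mem_comb hs _ k))
  simpa [upX] using (excess_bounds hhi hb hc.le ha).2

/-! ### Expected time to saturation -/

/-- `meanSteps F hi c n s = ∑_{k<n} (1 − h_{k+1}(s)) = E[min(τ, n)]`: the expected number of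
NON-saturating (fully absorbed) increments among the first `n`. -/
def meanSteps (F : Finset K) (hi c : K) (n : ℕ) (s : K) : K :=
  ∑ k ∈ range n, (1 - hitProb F (upX hi) c (k + 1) s)

omit [IsStrictOrderedRing K] in
/-- `c·E[min(τ,n)] = n·c − c·∑_{j≤n} h_j`. -/
theorem mul_meanSteps (F : Finset K) (hi c : K) (n : ℕ) (s : K) :
    c * meanSteps F hi c n s = n * c - c * ∑ k ∈ range n, hitProb F (upX hi) c (k + 1) s := by
  unfold meanSteps
  rw [sum_sub_distrib, sum_const, card_range, nsmul_eq_mul, mul_one]; ring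

/-- **Wald, stopping-time form**: `E ŝₙ = s + c·E[min(τ, n)]` under the top-gap hypothesis. -/
theorem wald_mean_eq_meanSteps {F : Finset K} {hi : K} (hhi : hi ∈ F) (hb : ∀ y ∈ F, y ≤ hi)
    {c : K} (hc : 0 < c) (hgap : ∀ y ∈ F, y < hi → y + c ≤ hi) {s : K} (hs : s ∈ F) (n : ℕ) :
    treeExp F (comb (fun _ => c) s n) (fun v => v) = s + c * meanSteps F hi c n s := by
  rw [wald_mean hhi hb hc hgap hs n, mul_meanSteps]; ring

/-- **`c·E[min(τ, n)] ≤ hi − s` for every `n`** (no top-gap hypothesis needed). -/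
theorem meanSteps_le {F : Finset K} {hi : K} (hhi : hi ∈ F) (hb : ∀ y ∈ F, y ≤ hi) {c : K}
    (hc : 0 < c) {s : K} (hs : s ∈ F) (n : ℕ) : c * meanSteps F hi c n s ≤ hi - s := by
  have h1 := wald_mean_ge hhi hb hc hs n
  have h2 : treeExp F (comb (fun _ => c) s n) (fun v => v) ≤ hi :=
    treeExp_le_of_allOut F _ (allOut_mono F _ (fun a ha => hb a ha) (allOut_mem_comb hs _ n))
  rw [mul_meanSteps]; linarith

/-- **Survival bound (every format, no enumeration):**
`n·P(no saturation within n steps) ≤ (hi − s)/c`. -/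
theorem survival_le {F : Finset K} {hi : K} (hhi : hi ∈ F) (hb : ∀ y ∈ F, y ≤ hi) {c : K}
    (hc : 0 < c) {s : K} (hs : s ∈ F) (n : ℕ) :
    (n : K) * (1 - hitProb F (upX hi) c n s) ≤ (hi - s) / c := by
  have h1 : (n : K) * (1 - hitProb F (upX hi) c n s) ≤ meanSteps F hi c n s := by
    unfold meanSteps
    calc (n : K) * (1 - hitProb F (upX hi) c n s)
        = ∑ _k ∈ range n, (1 - hitProb F (upX hi) c n s) := by
          rw [sum_const, card_range, nsmul_eq_mul]
      _ ≤ ∑ k ∈ range n, (1 - hitProb F (upX hi) c (k + 1) s) :=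
          sum_le_sum fun k hk => sub_le_sub_left
            (hitProb_mono_steps F (upX hi) c s (Nat.succ_le_of_lt (mem_range.mp hk))) _
  rw [le_div_iff₀ hc]
  nlinarith [h1, meanSteps_le hhi hb hc hs n, hc]

/-- Under the top-gap hypothesis `lo + (hi − lo)·h_{n+1}(s) ≤ E ŝₙ` (`ŝₙ = hi` iff exited). -/
theorem wald_mean_lower {F : Finset K} {lo hi : K} (hlb : ∀ y ∈ F, lo ≤ y) (hhi : hi ∈ F)
    (hb : ∀ y ∈ F, y ≤ hi) {c : K} (hc : 0 < c) (hgap : ∀ y ∈ F, y < hi → y + c ≤ hi) {s : K}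
    (hs : s ∈ F) (n : ℕ) :
    lo + (hi - lo) * hitProb F (upX hi) c (n + 1) s
      ≤ treeExp F (comb (fun _ => c) s n) (fun v => v) := by
  have hec : upX hi (hi + c) = true := by simpa [upX] using hc
  have key : treeExp F (comb (fun _ => c) s n)
      (fun a => (hi - lo) * (if upX hi (a + c) then 1 else 0) + lo)
        = lo + (hi - lo) * hitProb F (upX hi) c (n + 1) s := by
    rw [treeExp_add_const, treeExp_mul_left,
      treeExp_exitNow_eq_hitProb hhi hb (upX_imp hi) hec s n, add_comm]
  rw [← key]
  refine treeExp_mono_of_allOut F _ (allOut_mono F _ (fun a ha => ?_) (allOut_mem_comb hs _ n))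
  by_cases h : hi < a + c
  · have ha' : a = hi := (upX_add_iff_eq hb hc hgap ha).mp h
    simp [upX, ha', hc]
  · have := hlb a ha
    simp [upX, h, this]

/-- **`c·E[min(τ, n)] ≥ (hi − s) − (hi − lo)·(1 − h_{n+1}(s))`** under the top-gap hypothesis. -/
theorem meanSteps_ge {F : Finset K} {lo hi : K} (hlb : ∀ y ∈ F, lo ≤ y) (hhi : hi ∈ F)
    (hb : ∀ y ∈ F, y ≤ hi) {c : K} (hc : 0 < c) (hgap : ∀ y ∈ F, y < hi → y + c ≤ hi) {s : K}
    (hs : s ∈ F) (n : ℕ) :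
    (hi - s) - (hi - lo) * (1 - hitProb F (upX hi) c (n + 1) s) ≤ c * meanSteps F hi c n s := by
  have h1 := wald_mean_lower hlb hhi hb hc hgap hs n
  rw [wald_mean_eq_meanSteps hhi hb hc hgap hs n] at h1
  linarith

/-- **Expected time to saturation, two-sided with an explicit rate**: under the top-gap hypothesis
`(hi − s)·(1 − (hi − lo)/(c·(n+1))) ≤ c·E[min(τ, n)] ≤ hi − s`; hence `E[τ] = (hi − s)/c`. -/
theorem meanSteps_two_sided {F : Finset K} {lo hi : K} (hlb : ∀ y ∈ F, lo ≤ y) (hhi : hi ∈ F)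
    (hb : ∀ y ∈ F, y ≤ hi) {c : K} (hc : 0 < c) (hgap : ∀ y ∈ F, y < hi → y + c ≤ hi) {s : K}
    (hs : s ∈ F) (n : ℕ) :
    (hi - s) * (1 - (hi - lo) / (c * (n + 1))) ≤ c * meanSteps F hi c n s
      ∧ c * meanSteps F hi c n s ≤ hi - s := by
  refine ⟨?_, meanSteps_le hhi hb hc hs n⟩
  have h1 := meanSteps_ge hlb hhi hb hc hgap hs n
  have h2 := survival_le hhi hb hc hs (n + 1)
  have hn : (0 : K) < c * (n + 1) := by positivity
  push_cast at h2
  rw [le_div_iff₀ hc] at h2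
  have h3 : (hi - lo) * (1 - hitProb F (upX hi) c (n + 1) s)
      ≤ (hi - lo) * ((hi - s) / (c * (n + 1))) := by
    refine mul_le_mul_of_nonneg_left ?_ (sub_nonneg.mpr (hlb hi hhi))
    rw [le_div_iff₀ hn]; nlinarith [h2]
  have h4 : (hi - s) * (1 - (hi - lo) / (c * (n + 1)))
      = (hi - s) - (hi - lo) * ((hi - s) / (c * (n + 1))) := by ring
  rw [h4]; linarith [h1, h3]

/-! ### Every minifloat format -/

/-- **Every format:** `c·E[min(τ, n)] ≤ maxRat − s` and
`n·P(no saturation in n steps) ≤ (maxRat − s)/c` for SR accumulation of any constant `c > 0` from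
any format value `s` (subnormals, both signs, every `n`; no enumeration). -/
theorem format_survival_le (φ : Format) {c : ℚ} (hc : 0 < c) {s : ℚ}
    (hs : s ∈ MiniFloat.valueSet φ) (n : ℕ) :
    c * meanSteps (MiniFloat.valueSet φ) φ.maxRat c n s ≤ φ.maxRat - s
      ∧ (n : ℚ) * (1 - hitProb (MiniFloat.valueSet φ) (upX φ.maxRat) c n s)
        ≤ (φ.maxRat - s) / c := by
  obtain ⟨_, hhi, hb⟩ := valueSet_bounds φ
  exact ⟨meanSteps_le hhi (fun y hy => (hb y hy).2) hc hs n,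
    survival_le hhi (fun y hy => (hb y hy).2) hc hs n⟩

/-! ### FP4 E2M1 and FP6 E3M2, counting by ones: the identities instantiated -/

namespace Count

/-- E2M1 has no value in the open top gap `(5, 6)` … indeed none in `(4, 6)`. -/
theorem e2m1_topGap : ∀ y ∈ FP4.e2m1, y < (6 : ℚ) → y + 1 ≤ 6 := by decide +kernel

/-- **E2M1, counting by ones from `1`, every `n`:** `E ŝ_{m+4} = 6 − 2^{−m}` exactly
(the Wald step with file XXIV's `h_{k+4}(1) = 1 − 2^{−k}`). -/
theorem e2m1_mean_ones (m : ℕ) :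
    treeExp FP4.e2m1 (comb (fun _ => (1 : ℚ)) 1 (m + 4)) (fun v => v) = 6 - (1 / 2) ^ m := by
  obtain ⟨_, hhi, _, hb⟩ := Box.e2m1_hull
  have h1 : (1 : ℚ) ∈ FP4.e2m1 := by decide +kernel
  induction m with
  | zero => decide +kernel
  | succ m ih =>
      rw [show m + 1 + 4 = (m + 4) + 1 by omega, treeMean_comb_succ, ih,
        treeExp_excess_eq hhi (fun y hy => (hb y hy).2) one_pos e2m1_topGap h1 (m + 4),
        show hitProb FP4.e2m1 (upX 6) 1 (m + 4 + 1) 1 = h ((m + 1) + 4) 1 from rfl, h_one,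
        pow_succ]
      ring

end Count

namespace CountE3M2

/-- E3M2 has no value in `(27, 28)` (indeed none in `(24, 28)`). -/
theorem e3m2_topGap : ∀ y ∈ Formats.e3m2, y < (28 : ℚ) → y + 1 ≤ 28 := by decide +kernel

/-- **E3M2, counting by ones: Wald.** `E ŝₙ = s + n − ∑_{j≤n} h_j(s)` with file XXIV's seven-state
chain `h`, for every start value `s ∈ F` and every `n`; and `(28 − s)(1 − 56/(n+1)) ≤ E[min(τ,n)]
≤ 28 − s` (from `0`: on average exactly 28 increments are absorbed). -/
theorem e3m2_wald {s : ℚ} (hs : s ∈ Formats.e3m2) (n : ℕ) :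
    treeExp Formats.e3m2 (comb (fun _ => (1 : ℚ)) s n) (fun v => v)
        = s + n * 1 - 1 * ∑ k ∈ range n, h (k + 1) s
      ∧ ((28 - s) * (1 - (28 - -28) / (1 * (n + 1))) ≤ 1 * meanSteps Formats.e3m2 28 1 n s
        ∧ 1 * meanSteps Formats.e3m2 28 1 n s ≤ 28 - s) := by
  obtain ⟨_, hhi, _, hb⟩ := LawE3M2.e3m2_hull
  exact ⟨wald_mean hhi (fun y hy => (hb y hy).2) one_pos e3m2_topGap hs n,
    meanSteps_two_sided (fun y hy => (hb y hy).1) hhi (fun y hy => (hb y hy).2) one_pos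
      e3m2_topGap hs n⟩

end CountE3M2

end Summit.Ventures.CertifiedArithmetic.LowPrec.SR
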